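import Literature.NumberTheory.EllipticCurves.ZpExtensionEisensteinTwistFreeProofs
import Literature.NumberTheory.EllipticCurves.ZpExtensionEisensteinOrdinaryInvariantsBoundProofs
import Literature.NumberTheory.EllipticCurves.ZpExtensionScalarTwistResidualQuotient
import Literature.NumberTheory.EllipticCurves.IwasawaAlgebraEisensteinCoefficientRingProofs
import Literature.NumberTheory.GaloisCohomology.Howard2004.PrincipalArtinianDivisibilityProofs
import HarnessLib

/-!
# Coordinates on `M ⊗ A_{m,j}(ψ)` adapted to a plus part: purity of the twisted plus part and fixed vectors
# modulo it (theorems only)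

`Proofs` file (theorems only; no definition, no named fact, no instance, no `sorry`).  Topic `NumberTheory/EllipticCurves`
(cell `pub/bsd-print-x9`, memo `HOME/x9-p1-w3/H5B-AT-P-PLAN-w3g5.md`, file V3a: the module inputs (PUR) and (H0) of
`Tower.map_levelCondition_one_eq_strictSubgroup` (V1) for Howard's `F_𝔮` at `v ∣ p`, at ONE level `j`).

Data: a level `j = a + 1`, an abelian group `M` with an additive isomorphism `e : M ≃ (ℤ/p^j)^2` ADAPTED to a subgroup
`Fil ≤ M` (`x ∈ Fil ↔ e(x)₁ = 0`: `Fil = ℤ/p^j · e⁻¹(δ₀)` is a direct summand — for `E[p^j]` and `Fil_v E[p^j]` at an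
ordinary `v ∣ p`), the `A_{m,j}`-basis `b = (1 ⊗ e⁻¹ δ₀, 1 ⊗ e⁻¹ δ₁)` of `W = M ⊗ A_{m,j}` (`Twisted.basisOfAddEquiv`), the
twisted plus part `F = span {c ⊗ x : x ∈ Fil}`.
* §1 `EisensteinCoeff.exists_eq_natCast_mul_of_pow_mul_eq_zero` — in `A_{m,a+1}` (principal Artinian of length `m(a+1)`,
  `p = −[T]^m`, x10b-p1's `natCast_eq_neg_mk_X_pow`): `p^a c = 0 ⇒ c ∈ pA`.
* §2 **`mem_twistedSpan_iff_repr_one_eq_zero`** — `z ∈ F ↔ (b.repr z)₁ = 0`; hence (PUR)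
  **`exists_mem_add_smul_of_pow_smul_mem`**: `p^a y ∈ F ⇒ y ∈ F + pW`.
* §3 **`repr_one_mem_of_forall_sub_mem`** — (H0): if `g ∈ Γ_K` stabilises `Fil` and `g − 1` is injective on `M / Fil`
  (non-anomalous), then every `b ∈ W` with `ψ(g)•g b − b ∈ F + p^a W` for the twisted action lies in `F + p^a W`
  (the twisted action multiplies the coordinate `(·)₁ mod F` by the unit `ψ(g) χ(g)`, `ψ(g) ∈ 1 + 𝔪`, `χ(g) − 1 ∈ (ℤ/p^j)ˣ`).
No summit statement is proved; BSD is not proved by any of this.  Seat `bsd-line-x9-p1-w3` g5.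

References: [Howard2004HeegnerKolyvagin] H.0, Rem. 1.1.4, §3.1–3.2 (arXiv:1202.6340 p. 5, p. 7, p. 15–16); [GreenbergLNM1716] §2;
[BourbakiAlgebre1a3] Ch. II §5 no. 1 Prop. 4.
-/

set_option autoImplicit false

noncomputable section

open Function Field

namespace Literature.NumberTheory.EllipticCurves

namespace IwasawaAlgebra.EisensteinCoeff

variable {p : ℕ} [hp : Fact p.Prime] {m : ℕ}

/-! ## §1 `p^a c = 0 ⇒ c ∈ p A_{m,a+1}` -/

/-- **`p^a c = 0` in `A_{m,a+1}` forces `c ∈ p A_{m,a+1}`** (`m ≥ 1`): `A_{m,a+1}` is principal Artinian local of length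
`m(a+1)` with uniformiser `[T]` and `p = −[T]^m`, so `[T]^{ma} c = 0 ⇒ c ∈ ([T]^m) = (p)`.
[cite: Howard2004HeegnerKolyvagin, Rem. 1.1.4 (arXiv p. 5, L100–105)] -/
theorem exists_eq_natCast_mul_of_pow_mul_eq_zero (hm : 1 ≤ m) (a : ℕ) (c : EisensteinCoeff p m (a + 1))
    (hc : ((p : ℕ) : EisensteinCoeff p m (a + 1)) ^ a * c = 0) :
    ∃ c' : EisensteinCoeff p m (a + 1), c = (p : ℕ) * c' := by
  letI := isLocalRing_eisensteinCoeff p hm (Nat.succ_pos a)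
  have hmax := maximalIdeal_eisensteinCoeff_eq p hm (Nat.succ_pos a)
  have hn : (Ideal.Quotient.mk _ PowerSeries.X : EisensteinCoeff p m (a + 1)) ^ (m * (a + 1)) = 0 :=
    mk_X_pow_mul_eq_zero m (a + 1)
  have hn' : m * (a + 1) ≠ 0 → (Ideal.Quotient.mk _ PowerSeries.X : EisensteinCoeff p m (a + 1)) ^ (m * (a + 1) - 1) ≠ 0 :=
    fun _ ↦ mk_X_pow_ne_zero hm (Nat.succ_pos a)
  have h0 : (Ideal.Quotient.mk _ PowerSeries.X : EisensteinCoeff p m (a + 1)) ^ (m * a) * c = 0 := by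
    have h := hc
    rw [natCast_eq_neg_mk_X_pow (p := p) m (a + 1), neg_pow, ← pow_mul, mul_assoc] at h
    exact ((isUnit_one.neg.pow a).mul_right_eq_zero).mp h
  have hπ : (Ideal.Quotient.mk _ PowerSeries.X : EisensteinCoeff p m (a + 1)) ^ (m * a) * c ∈
      Ideal.span {(Ideal.Quotient.mk _ PowerSeries.X : EisensteinCoeff p m (a + 1)) ^ (m + m * a)} := by
    rw [h0]; exact Ideal.zero_mem _
  have hmem := Literature.NumberTheory.GaloisCohomology.Howard2004.mem_span_pow_of_pow_mul_mem hmax hn hn' (c := m)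
    (n := m * a) (by rw [Nat.mul_succ]; omega) hπ
  obtain ⟨d, hd⟩ := Ideal.mem_span_singleton'.mp hmem
  refine ⟨-d, ?_⟩
  rw [natCast_eq_neg_mk_X_pow (p := p) m (a + 1), ← hd]; ring

end IwasawaAlgebra.EisensteinCoeff

/-! ## §2 Coordinates adapted to the plus part; purity -/

namespace IwasawaAlgebra.EisensteinCoeff.Twisted

open IwasawaAlgebra IwasawaAlgebra.EisensteinCoeff

variable {p : ℕ} [hp : Fact p.Prime] {m j : ℕ} {M : Type} [AddCommGroup M]
  (e : M ≃+ (Fin 2 → ZMod (p ^ j))) (Fil : AddSubgroup M) (he : ∀ x : M, x ∈ Fil ↔ e x 1 = 0)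

/-- The second basis coordinate of a pure tensor: `(b.repr (c ⊗ x))₁ = c · e(x)₁`.
[cite: BourbakiAlgebre1a3, Ch. II §5 no. 1 Prop. 4] -/
theorem repr_tmul_one (c : EisensteinCoeff p m j) (x : M) :
    (Twisted.basisOfAddEquiv (m := m) e).repr (Twisted.tmul c x) 1 = c * (ZMod.cast (e x 1) : EisensteinCoeff p m j) :=
  Twisted.basisOfAddEquiv_repr_tmul e c x 1

include he in
/-- **`z ∈ F ↔ (b.repr z)₁ = 0`** for the twisted plus part `F = span {c ⊗ x : x ∈ Fil}` and the basis adapted to `Fil`.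
[cite: Howard2004HeegnerKolyvagin, H.0 and §3.1 (arXiv p. 7 L57, p. 15 L56–62: Fil_v T_𝔮 = Fil_v T ⊗ S_𝔮, a direct summand)] -/
theorem mem_twistedSpan_iff_repr_one_eq_zero (z : Twisted p m j M) :
    z ∈ Submodule.span ℤ {x : Twisted p m j M | ∃ (c : EisensteinCoeff p m j) (a : M), a ∈ Fil ∧ x = Twisted.tmul c a} ↔
      (Twisted.basisOfAddEquiv (m := m) e).repr z 1 = 0 := by
  constructor
  · intro hz
    have hz' : z ∈ AddSubgroup.closure
        {x : Twisted p m j M | ∃ (c : EisensteinCoeff p m j) (a : M), a ∈ Fil ∧ x = Twisted.tmul c a} := by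
      have h := Submodule.span_int_eq_addSubgroupClosure
        {x : Twisted p m j M | ∃ (c : EisensteinCoeff p m j) (a : M), a ∈ Fil ∧ x = Twisted.tmul c a}
      rw [SetLike.ext_iff] at h
      exact (h z).mp hz
    clear hz
    induction hz' using AddSubgroup.closure_induction with
    | mem y hy =>
      obtain ⟨c, a, ha, rfl⟩ := hy
      rw [repr_tmul_one, (he a).mp ha, ZMod.cast_zero, mul_zero]
    | zero => rw [map_zero, Finsupp.zero_apply]
    | add y w _ _ hy hw => rw [map_add, Finsupp.add_apply, hy, hw, add_zero]
    | neg y _ hy => rw [map_neg, Finsupp.neg_apply, hy, neg_zero]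
  · intro hz
    have hsum := (Twisted.basisOfAddEquiv (m := m) e).sum_repr z
    rw [Fin.sum_univ_two, hz, zero_smul, add_zero, Twisted.basisOfAddEquiv_apply, Twisted.smul_tmul, mul_one] at hsum
    rw [← hsum]
    refine Submodule.subset_span ⟨_, e.symm (Pi.single 0 1), (he _).mpr ?_, rfl⟩
    rw [AddEquiv.apply_symm_apply, Pi.single_apply, if_neg one_ne_zero]

include he in
/-- **(PUR) `p^a y ∈ F ⇒ y ∈ F + p W`** at level `j = a + 1`: the coordinate `(b.repr y)₁ ∈ A_{m,a+1}` is killed by `p^a`,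
hence divisible by `p` (§1). [cite: Howard2004HeegnerKolyvagin, H.0, Rem. 1.1.4 and §3.1 (arXiv p. 5, p. 7, p. 15)] [cite: GreenbergLNM1716, §2] -/
theorem exists_mem_add_smul_of_pow_smul_mem (hm : 1 ≤ m) {a : ℕ} (hj : j = a + 1) (y : Twisted p m j M)
    (hy : (p ^ a) • y ∈ Submodule.span ℤ
      {x : Twisted p m j M | ∃ (c : EisensteinCoeff p m j) (a : M), a ∈ Fil ∧ x = Twisted.tmul c a}) :
    ∃ φ ∈ Submodule.span ℤ {x : Twisted p m j M | ∃ (c : EisensteinCoeff p m j) (a : M), a ∈ Fil ∧ x = Twisted.tmul c a},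
      ∃ y' : Twisted p m j M, y = φ + p • y' := by
  subst hj
  set b := Twisted.basisOfAddEquiv (m := m) e with hb
  have h1 : ((p : ℕ) : EisensteinCoeff p m (a + 1)) ^ a * b.repr y 1 = 0 := by
    have h := (mem_twistedSpan_iff_repr_one_eq_zero e Fil he _).mp hy
    rwa [← Nat.cast_smul_eq_nsmul (EisensteinCoeff p m (a + 1)), map_smul, Finsupp.smul_apply, smul_eq_mul,
      Nat.cast_pow] at h
  obtain ⟨c', hc'⟩ := EisensteinCoeff.exists_eq_natCast_mul_of_pow_mul_eq_zero hm a _ h1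
  have hsum := b.sum_repr y
  rw [Fin.sum_univ_two] at hsum
  refine ⟨b.repr y 0 • b 0, ?_, c' • b 1, ?_⟩
  · refine (mem_twistedSpan_iff_repr_one_eq_zero e Fil he _).mpr ?_
    rw [map_smul, Finsupp.smul_apply, b.repr_self, Finsupp.single_apply, if_neg zero_ne_one, smul_zero]
  · conv_lhs => rw [← hsum]
    rw [hc', mul_smul, Nat.cast_smul_eq_nsmul]

/-! ## §3 (H0): fixed vectors modulo `F + p^a W` -/

variable {K : Type} [Field K] (κ : ZpExtension K p) [TopologicalSpace M] [DiscreteTopology M]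
  (ρ : GaloisRepresentations.DiscreteGaloisModule K M)

/-- `ψ(g) − 1 ∈ 𝔪 = ([T])`: the twisting unit `(1+T)^{e(g)}` is `≡ 1 (mod [T])`. [cite: Howard2004HeegnerKolyvagin, §2.2 (γ ↦ 1 + T)] -/
theorem onePlusT_pow_sub_one_mem_span (n : ℕ) :
    onePlusT p m j ^ n - 1 ∈ Ideal.span {(Ideal.Quotient.mk _ PowerSeries.X : EisensteinCoeff p m j)} := by
  obtain ⟨q, hq⟩ := sub_dvd_pow_sub_pow ((1 : IwasawaAlgebra p) + PowerSeries.X) 1 n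
  rw [one_pow, add_sub_cancel_left] at hq
  rw [onePlusT_def, ← map_pow, ← map_one (Ideal.Quotient.mk _), ← map_sub, hq, map_mul]
  exact Ideal.mul_mem_right _ _ (Ideal.mem_span_singleton_self _)

/-- In `ℤ/p^j`: a non-unit is killed by `p^{j-1}`. [folklore] -/
private theorem pow_pred_mul_eq_zero_of_not_isUnit {j : ℕ} (hj : 1 ≤ j) {s : ZMod (p ^ j)} (hs : ¬IsUnit s) :
    ((p ^ (j - 1) : ℕ) : ZMod (p ^ j)) * s = 0 := by
  haveI : NeZero (p ^ j) := ⟨pow_ne_zero j hp.out.ne_zero⟩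
  have hval : s = ((s.val : ℕ) : ZMod (p ^ j)) := (ZMod.natCast_zmod_val s).symm
  have hdvd : p ∣ s.val := by
    by_contra hnd
    apply hs
    rw [hval, ZMod.isUnit_iff_coprime]
    exact Nat.Coprime.pow_right j ((Nat.Prime.coprime_iff_not_dvd hp.out).mpr hnd).symm
  obtain ⟨t, ht⟩ := hdvd
  rw [hval, ht, ← Nat.cast_mul, ← mul_assoc, ← pow_succ, Nat.sub_add_cancel hj, Nat.cast_mul, ZMod.natCast_self,
    zero_mul]

/-- In `ℤ/p^j` (`j ≥ 1`): `p^{j-1} ≠ 0`. [folklore] -/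
private theorem pow_pred_ne_zero {j : ℕ} (hj : 1 ≤ j) : ((p ^ (j - 1) : ℕ) : ZMod (p ^ j)) ≠ 0 := by
  rw [Ne, ZMod.natCast_eq_zero_iff, Nat.pow_dvd_pow_iff_le_right hp.out.one_lt]
  omega

/-- In a local ring an element of the maximal ideal plus a unit is a unit. [folklore] -/
private theorem isUnit_add_of_mem_maximalIdeal {R : Type} [CommRing R] [IsLocalRing R] {x y : R}
    (hx : x ∈ IsLocalRing.maximalIdeal R) (hy : IsUnit y) : IsUnit (x + y) := by
  by_contra h
  have hxy : x + y ∈ IsLocalRing.maximalIdeal R := (IsLocalRing.mem_maximalIdeal _).mpr h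
  have : y ∈ IsLocalRing.maximalIdeal R := by
    have h' := Ideal.sub_mem _ hxy hx
    rwa [add_sub_cancel_left] at h'
  exact (IsLocalRing.mem_maximalIdeal _).mp this hy

include he in
/-- The eigenvalue of `g` on `M / Fil ≅ ℤ/p^j` minus one is a unit when `g − 1` is injective modulo `Fil` (non-anomalous
case): otherwise `p^{j-1} e⁻¹(δ₁)` would be fixed modulo `Fil` without lying in `Fil`.
[cite: Howard2004HeegnerKolyvagin, §3.2 (arXiv p. 16, L5–6)] [cite: GreenbergLNM1716, §2 (the action on 𝓕(𝔪̄)[p] and Ẽ[p])] -/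
theorem isUnit_coord_sub_one (hj : 1 ≤ j) (g : absoluteGaloisGroup K)
    (hg1 : ∀ x : M, ρ g x - x ∈ Fil → x ∈ Fil) :
    IsUnit (e (ρ g (e.symm (Pi.single 1 1))) 1 - 1) := by
  by_contra hs
  have hkill := pow_pred_mul_eq_zero_of_not_isUnit (p := p) hj hs
  set Q : M := e.symm (Pi.single 1 1) with hQ
  have heQ : e Q 1 = 1 := by rw [hQ, AddEquiv.apply_symm_apply, Pi.single_eq_same]
  -- `x = p^{j-1} Q` is fixed modulo `Fil`
  have hx : ρ g ((p ^ (j - 1)) • Q) - (p ^ (j - 1)) • Q ∈ Fil := by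
    rw [he, map_nsmul, ← smul_sub, map_nsmul, Pi.smul_apply, map_sub, Pi.sub_apply, heQ, nsmul_eq_mul]
    exact hkill
  have hxFil := hg1 _ hx
  rw [he, map_nsmul, Pi.smul_apply, heQ, nsmul_eq_mul, mul_one] at hxFil
  exact pow_pred_ne_zero (p := p) hj hxFil

include he in
/-- **(H0) Fixed vectors modulo `F + p^a W` lie in `F + p^a W`** (level `j ≥ 1`, `m ≥ 1`): if `g ∈ Γ_K` stabilises `Fil` and
`g − 1` is injective on `M / Fil`, and `ψ(g)g · b − b ∈ F + p^a W` for the twisted action `ψ(g) g` on `W = M ⊗ A_{m,j}(ψ)`,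
then `b ∈ F + p^a W`: the coordinate `(·)₁` modulo `F` is multiplied by the unit `ψ(g)χ(g)` (`ψ(g) ∈ 1 + 𝔪`, `χ(g) − 1` a unit).
[cite: Howard2004HeegnerKolyvagin, §2.2 and §3.1–3.2 (arXiv p. 15 L62–66, p. 16 L5–6)] [cite: GreenbergLNM1716, §2] -/
theorem exists_mem_add_pow_smul_of_twist_sub_mem (hm : 1 ≤ m) (hj : 1 ≤ j) (a : ℕ) (g : absoluteGaloisGroup K)
    (hgFil : ∀ x ∈ Fil, ρ g x ∈ Fil) (hg1 : ∀ x : M, ρ g x - x ∈ Fil → x ∈ Fil) (b : Twisted p m j M)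
    (hb : ∃ φ ∈ Submodule.span ℤ
        {x : Twisted p m j M | ∃ (c : EisensteinCoeff p m j) (a : M), a ∈ Fil ∧ x = Twisted.tmul c a},
      ∃ z : Twisted p m j M, κ.eisensteinTwist ρ hm j g b - b = φ + (p ^ a) • z) :
    ∃ φ₀ ∈ Submodule.span ℤ
        {x : Twisted p m j M | ∃ (c : EisensteinCoeff p m j) (a : M), a ∈ Fil ∧ x = Twisted.tmul c a},
      ∃ z₀ : Twisted p m j M, b = φ₀ + (p ^ a) • z₀ := by
  letI := isLocalRing_eisensteinCoeff p hm hj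
  haveI := EisensteinCoeff.charP p hm j
  set A := EisensteinCoeff p m j with hA
  set B := Twisted.basisOfAddEquiv (m := m) e with hB
  set u : A := onePlusT p m j ^ κ.twistExponent (ZpExtension.eisensteinLevel (p := p) hm j) g with hu
  set χ : A := (ZMod.cast (e (ρ g (e.symm (Pi.single 1 1))) 1) : A) with hχ
  -- the coordinate `(·)₁` of the twisted action
  have hcoord : ∀ w : Twisted p m j M, B.repr (κ.eisensteinTwist ρ hm j g w) 1 = u * χ * B.repr w 1 := by
    intro w
    have hsum := B.sum_repr w
    rw [Fin.sum_univ_two, hB, Twisted.basisOfAddEquiv_apply, Twisted.basisOfAddEquiv_apply, Twisted.smul_tmul,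
      Twisted.smul_tmul, mul_one, mul_one, ← hB] at hsum
    conv_lhs => rw [← hsum]
    rw [map_add, κ.eisensteinTwist_apply_tmul, κ.eisensteinTwist_apply_tmul, map_add, Finsupp.add_apply, hB,
      repr_tmul_one, repr_tmul_one, ← hB]
    have h0 : e (ρ g (e.symm (Pi.single 0 1))) 1 = 0 :=
      (he _).mp (hgFil _ ((he _).mpr (by rw [AddEquiv.apply_symm_apply, Pi.single_apply, if_neg one_ne_zero])))
    rw [h0, ZMod.cast_zero, mul_zero, zero_add, ← hu, ← hχ]
    ring
  -- `u χ - 1` is a unit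
  have hunit : IsUnit (u * χ - 1) := by
    have hsplit : u * χ - 1 = (u - 1) * χ + (χ - 1) := by ring
    rw [hsplit]
    refine isUnit_add_of_mem_maximalIdeal (Ideal.mul_mem_right _ _ ?_) ?_
    · rw [maximalIdeal_eisensteinCoeff_eq p hm hj]
      exact onePlusT_pow_sub_one_mem_span _
    · have hcast : χ - 1 = ZMod.castHom (dvd_refl (p ^ j)) A (e (ρ g (e.symm (Pi.single 1 1))) 1 - 1) := by
        rw [map_sub, map_one, ZMod.castHom_apply]
      rw [hcast]
      exact (isUnit_coord_sub_one e Fil he ρ hj g hg1).map _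
  -- membership in `F + p^a W` through the coordinate
  obtain ⟨φ, hφ, z, hz⟩ := hb
  have hφ1 : B.repr φ 1 = 0 := (mem_twistedSpan_iff_repr_one_eq_zero e Fil he φ).mp hφ
  have hlam : (u * χ - 1) * B.repr b 1 = ((p : A) ^ a) * B.repr z 1 := by
    have h := congrArg (fun w ↦ B.repr w 1) hz
    simp only [map_sub, map_add, Finsupp.sub_apply, Finsupp.add_apply] at h
    rw [hcoord, hφ1, zero_add, ← Nat.cast_smul_eq_nsmul A, map_smul, Finsupp.smul_apply, smul_eq_mul,
      Nat.cast_pow] at h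
    rw [← h]; ring
  obtain ⟨w, hw⟩ := hunit
  have hb1 : B.repr b 1 = ((p : A) ^ a) * (↑w⁻¹ * B.repr z 1) := by
    rw [← mul_assoc, mul_comm ((p : A) ^ a), mul_assoc, ← hlam, ← hw, ← mul_assoc, Units.inv_mul, one_mul]
  have hsum := B.sum_repr b
  rw [Fin.sum_univ_two] at hsum
  refine ⟨B.repr b 0 • B 0, (mem_twistedSpan_iff_repr_one_eq_zero e Fil he _).mpr ?_, (↑w⁻¹ * B.repr z 1) • B 1, ?_⟩
  · rw [map_smul, Finsupp.smul_apply, B.repr_self, Finsupp.single_apply, if_neg zero_ne_one, smul_zero]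
  · have hpa : ((p : A) ^ a) • ((↑w⁻¹ * B.repr z 1) • B 1) = (p ^ a) • ((↑w⁻¹ * B.repr z 1) • B 1) := by
      rw [← Nat.cast_smul_eq_nsmul A (p ^ a), Nat.cast_pow]
    conv_lhs => rw [← hsum]
    rw [hb1, mul_smul, hpa]

end IwasawaAlgebra.EisensteinCoeff.Twisted

end Literature.NumberTheory.EllipticCurves

end
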